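import Summits.NavierStokesRegularity.FluidComputer.PalasekTowerHeredityWitness
import Summits.NavierStokesRegularity.FluidComputer.PalasekTowerRegisterGlobalHeredity

/-!
# REGISTER v2.3′: `heredity_at_one ⇐ HeredityWitness 1` — the first-rung stub reduced to its typed witness

Cell `ns-blowup`, seat `ns-blowup-ecbridge-6` (D-0074 GROUP C «BRIDGE SUPPORT»; bears_on LADDER-NS N1,
route `PalasekTowerBreakdown`, crux item stmt-NavierStokesRegularity-19178 `EpisodeInduction`, BC3 stub
`heredity_at_one : HeredityAtOne`). Companion of `PalasekTowerHeredityWitness.lean` (this seat: the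
level witness `Schedule.LevelWitness`, the hypothesis `HeredityWitness k`, the reduction
`Stage.nonempty_extends_of_levelWitness`) and of `PalasekTowerRegisterGlobalHeredity.lean` (p415576,
ecbridge-1: the names `HeredityAt`, `HeredityFrom`, `HeredityAtOne`). LABEL: E–C typing (KERNEL;
every statement here is a composition of accepted theorems, BY NAME on p415576's declarations).
WHAT THIS IS NOT: not Navier–Stokes evidence — nothing is constructed or asserted; `hU` (Tao 2013
Cor. 11.4 with force, the route's W14 binder) is a hypothesis wherever it appears.

* `HeredityAt.heredityWitness : HeredityAt k → HeredityWitness k` (free);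
* `HeredityWitness.heredityAt (hU) : HeredityWitness k → HeredityAt k`, hence
  `heredityAt_iff_heredityWitness (hU)` — modulo `hU` the two statements are EQUIVALENT at every
  level (nothing weaker or stronger is substituted);
* THE STUB REDUCTION `heredityAtOne_of_heredityWitness (hU) : HeredityWitness 1 → HeredityAtOne`, in
  both spellings of `hU` (`tao_unconditional_uniqueness_velocity_forced` and the route item's
  `Literature.Analysis.FluidPDE.tao2011_forced_unconditionalUniqueness_velocity`), and the free
  converse `HeredityAtOne.heredityWitness`;
* `heredityFrom_iff_heredityWitness (hU)`: `HeredityFrom k₀ ↔ ∀ k ≥ k₀, HeredityWitness k` (so the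
  planner's split child `HeredityFromTwo = HeredityFrom 2` reads as the witnesses at all `k ≥ 2`).

References: S. Palasek, arXiv:2605.13827 §4 [cite: Palasek2026ElementaryModel, §4]; T. Tao, Anal.
PDE 6 (2013), Cor. 11.4 [cite: Tao2011, Cor. 11.4].
-/

noncomputable section

namespace Summit.NavierStokesRegularity.FluidComputer.PalasekTowerClayBridge

open Set MeasureTheory Filter Topology Function Real
open scoped ENNReal ContDiff NNReal
open Literature.Analysis.FluidPDE

/-- **Heredity at level `k` implies the heredity witness at level `k`** (no uniqueness needed: the
extension stage is a witness). [folklore] -/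
theorem HeredityAt.heredityWitness {k : ℕ} (h : HeredityAt k) : HeredityWitness k := by
  rintro S hP hR hQ ⟨s⟩
  obtain ⟨s', -⟩ := h S hP hR hQ s
  exact s'.levelWitness

/-- **The heredity witness at level `k` gives heredity at level `k`, given forced unconditional
uniqueness** (`hU`, Tao 2013 Cor. 11.4 with its force slot). [cite: Tao2011, Cor. 11.4] -/
theorem HeredityWitness.heredityAt {k : ℕ} (hU : tao_unconditional_uniqueness_velocity_forced)
    (h : HeredityWitness k) : HeredityAt k :=
  fun S hP hR hQ s => s.nonempty_extends_of_levelWitness hU one_pos (h S hP hR hQ ⟨s⟩)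

/-- **Modulo `hU` the two statements are EQUIVALENT**: heredity at level `k` ⇔ the heredity witness
at level `k`. [cite: Tao2011, Cor. 11.4] -/
theorem heredityAt_iff_heredityWitness {k : ℕ} (hU : tao_unconditional_uniqueness_velocity_forced) :
    HeredityAt k ↔ HeredityWitness k :=
  ⟨HeredityAt.heredityWitness, HeredityWitness.heredityAt hU⟩

/-- **THE REDUCTION OF THE FIRST-RUNG STUB**: `heredity_at_one ⇐ HeredityWitness 1`, given `hU` in
the bridge's Schwartz-force spelling `tao_unconditional_uniqueness_velocity_forced`.
[cite: Tao2011, Cor. 11.4] -/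
theorem heredityAtOne_of_heredityWitness (hU : tao_unconditional_uniqueness_velocity_forced)
    (h : HeredityWitness 1) : HeredityAtOne :=
  heredityAtOne_iff.2 (h.heredityAt hU)

/-- **The same reduction with `hU` spelled as the route's support item `TaoForcedUniqueness`**
(W14 = `Literature.Analysis.FluidPDE.tao2011_forced_unconditionalUniqueness_velocity`, the binder of
the route's `closes`; fed through `.schwartzForce`). [cite: Tao2011, Cor. 11.4] -/
theorem heredityAtOne_of_heredityWitness_W14
    (hU : tao2011_forced_unconditionalUniqueness_velocity) (h : HeredityWitness 1) : HeredityAtOne :=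
  heredityAtOne_of_heredityWitness (tao2011_forced_unconditionalUniqueness_velocity.schwartzForce hU) h

/-- The first rung itself yields the witness at level `1` (free converse). [folklore] -/
theorem HeredityAtOne.heredityWitness (h : HeredityAtOne) : HeredityWitness 1 :=
  (heredityAtOne_iff.1 h).heredityWitness

/-- **Heredity from level `k₀` ⇔ the heredity witness at every level `k ≥ k₀`** (given `hU`); at
`k₀ = 2` this is the planner's split child `HeredityFrom 2` in witness form. [cite: Tao2011, Cor. 11.4] -/
theorem heredityFrom_iff_heredityWitness {k₀ : ℕ} (hU : tao_unconditional_uniqueness_velocity_forced) :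
    HeredityFrom k₀ ↔ ∀ k : ℕ, k₀ ≤ k → HeredityWitness k := by
  constructor
  · exact fun h k hk => (h.heredityAt hk).heredityWitness
  · intro h S hP hR hQ k hk s
    exact (h k hk).heredityAt hU S hP hR hQ s

end Summit.NavierStokesRegularity.FluidComputer.PalasekTowerClayBridge

end
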